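import Summits.RiemannHypothesis.RiemannHypothesis.Theorems.WeilFormatCDataO865FrontData
import Summits.RiemannHypothesis.RiemannHypothesis.Theorems.S2FormatCE0
import Literature.NumberTheory.LFunctions.YoshidaWindowGramTailMSSines
import Literature.NumberTheory.LFunctions.YoshidaWindowGramMiddleJBox
import Literature.NumberTheory.LFunctions.YoshidaWindowGramTailJFactoredScaled
import Literature.NumberTheory.LFunctions.YoshidaWindowGramTailMSFactored
import Literature.NumberTheory.LFunctions.YoshidaWindowGramTailJDiagTight
import Summits.RiemannHypothesis.RiemannHypothesis.Theorems.FormatCPsdBands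
import Summits.RiemannHypothesis.RiemannHypothesis.Theorems.WeilFormatCDiagShift
import HarnessLib

/-!
# Format C kernel rung `O865` (a = 173/200, column-band layout): odd sector: Schur rows 41…52 (lower triangle) of `M − U₁ − U₂` enclosed by `DS` within `rho`·2^-250 (kernel certificates)

Window `a = 173/200`; prime powers in the window: 2, 3, 2^2, 5; prime constant A = 1730/1000 (`WeilFormatC.primeCoeff_form_ge_cells_09`); evaluator parameters S = 2^256, Kpi 130, Kser 150, kred 8, Kexp 45, J 120; full table modes < 129; light column table modes < 515; units 2^-250 (Schur entries), 2^-124 (column digits, width 127), 2^-118 (tail-factor digits, width 121), 2^-64 (reciprocal weights), 2^-40 (tail base); order-J tail J = 4, θ = 1/2048, η = 1/10 | 4/1.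
Design row: sr-gb-rung-a A g22 odd λ-run (parity cell 8 L-side): a = 173/200, μ = 2^-60, odd 128 / exact [128,256) / middle [256,512) θm 1/1024 / MS tail 512 (η 4); λ_min(DS) = 2.90e-18 unshifted, 2.47e-18 shifted, δ = 2^-60, slack 1.06e13 (probes P865a/b/c: 64/128/256 not PD; 160/320/1024 λ_min 3.67e-18). Generated by sr-gb-rung-a prover A g22 with rh-explicit-weil-2 gen7's generator extended for the odd λ-run (--sector odd --mu-log2; HOME(A)/code-g22/gen7/gramgen7.py sha16 2c3ef6c62b846d3c) from `#eval` of the tree's `Encl` functions; every datum is re-verified by the kernel in the theorem files (`decide +kernel`). Helper data of the rh-explicit Weil-positivity programme (format C, K-CELL-2), RH-free. [cite: Yoshida1992HermitianForms, §5 (5.15)-(5.16) p. 301; §7 pp. 305–312]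
-/

set_option linter.dupNamespace false
set_option maxRecDepth 200000

namespace Summit.RiemannHypothesis.RiemannHypothesis.Theorems.WeilFormatCData.O865CBOdd
open Literature.NumberTheory.LFunctions Literature.NumberTheory.LFunctions.Yoshida1992 Encl Literature.Analysis.ValidatedNumerics.NumericsMP
open Summit.RiemannHypothesis.RiemannHypothesis.Theorems.WeilFormatCData.O865

/-- kernel: Schur rows `[41, 53)` (columns `j ≤ i`). -/
theorem tS41 : checkSchurBandG (2 ^ 256) 250 O865CBOdd.rho O865.C O865.tab true 128 (subBoxCB (2 ^ 256) 127 128 124 64 O865CBOdd.ρc O865CBOdd.XP O865CBOdd.Pd O865CBOdd.v O865CBOdd.V 121 8 118 118 O865CBOdd.ρφ O865CBOdd.ρψ O865CBOdd.ΦP O865CBOdd.ΨP O865CBOdd.Pφ O865CBOdd.Pψ (fun i ↦ (dMidOBox (2 ^ 256) O865.C O865.F (tget O865.tab (i + 1)) 1 1024 128 4 O865.momO i).add (dgJoBoxT (2 ^ 256) O865.C O865.F (tget O865.tab (i + 1)) 40 1279231190568 128 512 4 1 2048 i))) O865CBOdd.DS true 41 12 = true := by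
  decide +kernel

end Summit.RiemannHypothesis.RiemannHypothesis.Theorems.WeilFormatCData.O865CBOdd
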